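import Mathlib
import Literature.Analysis.FluidPDE.SelfSimilar
import Literature.Analysis.FluidPDE.AxisymmetricEuler
import Literature.Analysis.FluidPDE.TypeIAncientMild
import Summits.NavierStokesRegularity.NavierStokesRegularity.Theorems.DssFarFieldSlavingBlowupTypeIDssProfileSmoothRepresentativeAe
import Summits.NavierStokesRegularity.NavierStokesRegularity.Theorems.DssFarFieldSlavingBlowupTypeIDssProfileClassToProfile
import Summits.NavierStokesRegularity.NavierStokesRegularity.Theorems.CorkscrewDynamoCorkscrewProfileAngleTools
import Summits.NavierStokesRegularity.NavierStokesRegularity.Theorems.DssFarFieldSlavingBlowupTypeIDssProfileRotatingMirror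
import Summits.NavierStokesRegularity.NavierStokesRegularity.Theorems.DssFarFieldSlavingBlowupTypeIDssProfileTiltedIsotropyCalculus
import Summits.NavierStokesRegularity.NavierStokesRegularity.Theorems.DssFarFieldSlavingBlowupTypeIDssProfileTiltedIsotropy
import Summits.NavierStokesRegularity.NavierStokesRegularity.Theorems.DssFarFieldSlavingBlowupTypeIDssProfileSpatioTemporal
import HarnessLib

/-!
# T23, part 3 — K0g / T25T: at INFINITE-ORDER twist ONE non-commuting spatial symmetry (reversing OR tilted)
  empties the cell; tilted spatio-temporal symmetries follow
  (route `DssFarFieldSlaving`, crux `BlowupTypeIDssProfile`, stmt-NavierStokesRegularity-0155 — SUPPORT;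
  cell pub-ns-dss; statements and proofs: theory seat g3, section «T25T» (L703–946) of
  `HOME/theory/TiltedIsotropyEmptyTreeT25.lean` sha256[16] eaeac82e8044acd5; the typer made it a separate
  file importing parts 1–2 and the landed T25 file, wrote `R_φ m R_{−φ}` out as
  `((rotZLIE (−φ)).trans m).trans (rotZLIE φ)`, unfolded the sketch's `def SliceSym`, and replaced the
  private copy of the commutator lemma by the landed `SpatioTemporal.slices_equivariant_commutator` —
  nothing else)

HONEST FRAMING. A Liouville-type exclusion of symmetry cells of the rotated-DSS census class of
`FilamentSkeletonRss.RdssProfileTruncation`; no claim about Navier–Stokes regularity or blow-up, no number.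

If a Type-I ancient mild field is `(c, R_θ)`-RDSS on negative times with `θ/2π ∉ ℚ` and every slice has
ONE common linear-isometric symmetry `m` that does not commute with the rotations about the axis
(REVERSING or TILTED), the field is trivial: conjugating by the RDSS structure and by its inverse puts
`R_{jθ} m R_{−jθ}` (`j ∈ ℤ`) into the isotropy of every slice (`conj_symm_of_rdss`, `rdss_symm`),
closedness and the density of `ℤθ + 2πℤ` give the whole conjugation orbit `R_φ m R_{−φ}`
(`conjOrbit_of_infiniteTwist`), and T23 (`TiltedIsotropy.corotatingIsotropy_trivial` with `α = 1`) forces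
axisymmetry, whence KNSS: `infiniteTwist_noncommutingIsotropy_trivial` (Oseen gauge), CLASS level
`rdssClass_infiniteTwist_noncommutingIsotropy_empty` — the landed K0d
(`ReversingIsotropy.rdssClass_reversing_infiniteOrder_empty`, `m` reversing) with «reversing» weakened to
«non-commuting» (so K0d ⊂ K0g; tilted `m`, `m e₃ ≠ ±e₃`, by `exists_not_commute_of_tilted`).  Combined
with the commutator lemma of T25 (`SpatioTemporal.slices_equivariant_commutator`, landed) it empties the
TILTED spatio-temporal symmetries at infinite-order twist: `spatioTemporal_noncommutingCommutator_trivial`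
(Oseen gauge) / `rdssClass_spatioTemporal_noncommutingCommutator_empty` (CLASS).
CENSUS READING (levels as named, lead A22/A79): at infinite-order twist the inertial slice isotropy of a
non-zero class member is `⊆ C_∞h`, and no spatio-temporal symmetry `(μ, g)` with non-commuting commutator
exists; NOT covered: finite-order twist (K1–K3 cells stay legitimate), `g ∈ C_∞h`, `α = 0`.
[cite: KochNadirashviliSereginSverak2009, §4 and Thm 5.3 (arXiv:0709.3599)]
[cite: GolubitskyStewart2002, Ch. 1 Thm 1.17/Prop 1.18; Ch. 6 Lemma 6.3, Thm 6.4, Ex. 6.6]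
-/

noncomputable section

set_option linter.dupNamespace false

namespace Summit.NavierStokesRegularity.NavierStokesRegularity.Theorems.TiltedIsotropy

open MeasureTheory Set Function Filter Metric WithLp
open Literature.Analysis.FluidPDE
open Summit.NavierStokesRegularity.NavierStokesRegularity.Theorems
open scoped Topology RealInnerProductSpace

/-- Conjugating a common symmetry of the slices by the RDSS map: `(c, A)`-RDSS on `t < 0` and
`h`-equivariance of every slice ⇒ `A⁻¹ h A`-equivariance of every slice. Pure algebra. -/
theorem conj_symm_of_rdss {c : ℝ} (hc : 0 < c) {A h : (EuclideanSpace ℝ (Fin 3)) ≃ₗᵢ[ℝ] (EuclideanSpace ℝ (Fin 3))} {V : ℝ → (EuclideanSpace ℝ (Fin 3)) → (EuclideanSpace ℝ (Fin 3))}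
    (hA : ∀ t < 0, ∀ x, c • A.symm (V (c ^ 2 * t) (c • A x)) = V t x)
    (hh : ∀ t < 0, ∀ x, V t (h x) = h (V t x)) :
    ∀ t < 0, ∀ x, V t (A.symm (h (A x))) = A.symm (h (A (V t x))) := by
  intro t ht x
  have hct : c ^ 2 * t < 0 := mul_neg_of_pos_of_neg (by positivity) ht
  rw [← hA t ht (A.symm (h (A x))), ← hA t ht x]
  simp only [LinearIsometryEquiv.apply_symm_apply, LinearIsometryEquiv.map_smul]
  rw [← h.map_smul, hh _ hct]

/-- The inverse RDSS structure on negative times: `(c, A)`-RDSS ⇒ `(c⁻¹, A⁻¹)`-RDSS. -/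
theorem rdss_symm {c : ℝ} (hc : 0 < c) {A : (EuclideanSpace ℝ (Fin 3)) ≃ₗᵢ[ℝ] (EuclideanSpace ℝ (Fin 3))} {V : ℝ → (EuclideanSpace ℝ (Fin 3)) → (EuclideanSpace ℝ (Fin 3))}
    (hA : ∀ t < 0, ∀ x, c • A.symm (V (c ^ 2 * t) (c • A x)) = V t x) :
    ∀ s < 0, ∀ y, c⁻¹ • A.symm.symm (V (c⁻¹ ^ 2 * s) (c⁻¹ • A.symm y)) = V s y := by
  intro s hs y
  have hcs : c⁻¹ ^ 2 * s < 0 := mul_neg_of_pos_of_neg (by positivity) hs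
  have h1 := hA (c⁻¹ ^ 2 * s) hcs (c⁻¹ • A.symm y)
  rw [show c ^ 2 * (c⁻¹ ^ 2 * s) = s by field_simp, LinearIsometryEquiv.map_smul,
    LinearIsometryEquiv.apply_symm_apply, smul_smul, mul_inv_cancel₀ hc.ne', one_smul] at h1
  rw [LinearIsometryEquiv.symm_symm, ← h1, LinearIsometryEquiv.map_smul,
    LinearIsometryEquiv.apply_symm_apply, smul_smul, inv_mul_cancel₀ hc.ne', one_smul]

/-- `R_{−θ} (R_φ m R_{−φ}) R_θ = R_{φ−θ} m R_{−(φ−θ)}`. -/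
theorem rotZLIE_symm_rotMirror_rotZLIE (m : (EuclideanSpace ℝ (Fin 3)) ≃ₗᵢ[ℝ] (EuclideanSpace ℝ (Fin 3))) (θ φ : ℝ) (x : (EuclideanSpace ℝ (Fin 3))) :
    (rotZLIE θ).symm ((((rotZLIE (-φ)).trans m).trans (rotZLIE φ)) (rotZLIE θ x)) = (((rotZLIE (-(φ - θ))).trans m).trans (rotZLIE (φ - θ))) x := by
  rw [rotZLIE_symm_apply, rotZLIE_apply, RotatingMirror.rotMirror_apply, RotatingMirror.rotMirror_apply, ← rotZ_add (-θ) φ,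
    ← rotZ_add (-φ) θ, show -θ + φ = φ - θ by ring, show -φ + θ = -(φ - θ) by ring]

/-- `R_θ (R_φ m R_{−φ}) R_{−θ} = R_{φ+θ} m R_{−(φ+θ)}`. -/
theorem rotZLIE_rotMirror_rotZLIE_symm (m : (EuclideanSpace ℝ (Fin 3)) ≃ₗᵢ[ℝ] (EuclideanSpace ℝ (Fin 3))) (θ φ : ℝ) (x : (EuclideanSpace ℝ (Fin 3))) :
    (rotZLIE θ).symm.symm ((((rotZLIE (-φ)).trans m).trans (rotZLIE φ)) ((rotZLIE θ).symm x)) = (((rotZLIE (-(φ + θ))).trans m).trans (rotZLIE (φ + θ))) x := by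
  rw [LinearIsometryEquiv.symm_symm, rotZLIE_symm_apply, rotZLIE_apply, RotatingMirror.rotMirror_apply,
    RotatingMirror.rotMirror_apply, ← rotZ_add θ φ, ← rotZ_add (-φ) (-θ), show θ + φ = φ + θ by ring,
    show -φ + -θ = -(φ + θ) by ring]

/-- The angle map `ψ ↦ R_ψ m R_{−ψ} w` is continuous. -/
private theorem continuous_rotMirror_angle (m : (EuclideanSpace ℝ (Fin 3)) ≃ₗᵢ[ℝ] (EuclideanSpace ℝ (Fin 3))) (w : (EuclideanSpace ℝ (Fin 3))) :
    Continuous fun ψ : ℝ => (((rotZLIE (-ψ)).trans m).trans (rotZLIE ψ)) w := by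
  have hd : ∀ ψ₀ : ℝ, HasDerivAt (fun ψ : ℝ => rotZ ψ (m (rotZ (-ψ) w)))
      (rotGen (rotZ ψ₀ (m (rotZ (-ψ₀) w))) + rotZ ψ₀ (m (-rotGen (rotZ (-ψ₀) w)))) ψ₀ := by
    intro ψ₀
    have h0 : HasDerivAt (fun θ => rotZ (-θ) w) (-rotGen (rotZ (-ψ₀) w)) ψ₀ := by
      simpa using hasDerivAt_rotZ_neg_comp (v := fun _ => w) (hasDerivAt_const ψ₀ w)
    have h1 : HasDerivAt (fun θ => m (rotZ (-θ) w)) (m (-rotGen (rotZ (-ψ₀) w))) ψ₀ :=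
      (m.toContinuousLinearEquiv : (EuclideanSpace ℝ (Fin 3)) →L[ℝ] (EuclideanSpace ℝ (Fin 3))).hasFDerivAt.comp_hasDerivAt ψ₀ h0
    exact hasDerivAt_rotZ_comp h1
  have hc : Continuous fun ψ : ℝ => rotZ ψ (m (rotZ (-ψ) w)) :=
    continuous_iff_continuousAt.2 fun ψ₀ => (hd ψ₀).continuousAt
  exact hc.congr fun ψ => (RotatingMirror.rotMirror_apply m ψ w).symm

/-- **Orbit lemma at infinite-order twist.** `(c, R_θ)`-RDSS on `t < 0`, `θ/2π ∉ ℚ`, continuous slices and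
ONE common symmetry `m` of the slices ⇒ every `R_φ m R_{−φ}` (`φ ∈ ℝ`) is a symmetry of every slice. -/
theorem conjOrbit_of_infiniteTwist {c θ : ℝ} (hc : 0 < c) (hθ : Irrational (θ / (2 * Real.pi)))
    (m : (EuclideanSpace ℝ (Fin 3)) ≃ₗᵢ[ℝ] (EuclideanSpace ℝ (Fin 3))) {V : ℝ → (EuclideanSpace ℝ (Fin 3)) → (EuclideanSpace ℝ (Fin 3))} (hVc : ∀ t < 0, Continuous (V t))
    (hR : ∀ t < 0, ∀ x, c • (rotZLIE θ).symm (V (c ^ 2 * t) (c • rotZLIE θ x)) = V t x)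
    (hsym : ∀ t < 0, ∀ x, V t (m x) = m (V t x)) : ∀ φ : ℝ, (∀ t < 0, ∀ x, V t ((((rotZLIE (-φ)).trans m).trans (rotZLIE φ)) x) = (((rotZLIE (-φ)).trans m).trans (rotZLIE φ)) (V t x)) := by
  -- one step down / up along `ℤθ`
  have hdown : ∀ φ : ℝ, (∀ t < 0, ∀ x, V t ((((rotZLIE (-φ)).trans m).trans (rotZLIE φ)) x) = (((rotZLIE (-φ)).trans m).trans (rotZLIE φ)) (V t x)) →
      (∀ t < 0, ∀ x, V t ((((rotZLIE (-(φ - θ))).trans m).trans (rotZLIE (φ - θ))) x) = (((rotZLIE (-(φ - θ))).trans m).trans (rotZLIE (φ - θ))) (V t x)) := by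
    intro φ hφ t ht x
    have h1 := conj_symm_of_rdss hc hR hφ t ht x
    rwa [rotZLIE_symm_rotMirror_rotZLIE, rotZLIE_symm_rotMirror_rotZLIE] at h1
  have hup : ∀ φ : ℝ, (∀ t < 0, ∀ x, V t ((((rotZLIE (-φ)).trans m).trans (rotZLIE φ)) x) = (((rotZLIE (-φ)).trans m).trans (rotZLIE φ)) (V t x)) →
      (∀ t < 0, ∀ x, V t ((((rotZLIE (-(φ + θ))).trans m).trans (rotZLIE (φ + θ))) x) = (((rotZLIE (-(φ + θ))).trans m).trans (rotZLIE (φ + θ))) (V t x)) := by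
    intro φ hφ t ht x
    have h1 := conj_symm_of_rdss (inv_pos.2 hc) (rdss_symm hc hR) hφ t ht x
    rwa [rotZLIE_rotMirror_rotZLIE_symm, rotZLIE_rotMirror_rotZLIE_symm] at h1
  have h0 : (∀ t < 0, ∀ x, V t ((((rotZLIE (-((0 : ℝ)))).trans m).trans (rotZLIE ((0 : ℝ)))) x) = (((rotZLIE (-((0 : ℝ)))).trans m).trans (rotZLIE ((0 : ℝ)))) (V t x)) := by
    intro t ht x
    rw [RotatingMirror.rotMirror_apply, RotatingMirror.rotMirror_apply, neg_zero, rotZ_zero, rotZ_zero, rotZ_zero, rotZ_zero]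
    exact hsym t ht x
  have hnat : ∀ n : ℕ, (∀ t < 0, ∀ x, V t ((((rotZLIE (-((n : ℝ) * θ))).trans m).trans (rotZLIE ((n : ℝ) * θ))) x) = (((rotZLIE (-((n : ℝ) * θ))).trans m).trans (rotZLIE ((n : ℝ) * θ))) (V t x)) ∧
      (∀ t < 0, ∀ x, V t ((((rotZLIE (-(-((n : ℝ) * θ)))).trans m).trans (rotZLIE (-((n : ℝ) * θ)))) x) = (((rotZLIE (-(-((n : ℝ) * θ)))).trans m).trans (rotZLIE (-((n : ℝ) * θ)))) (V t x)) := by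
    intro n
    induction n with
    | zero => simpa using h0
    | succ n ih =>
      constructor
      · have := hup _ ih.1
        rw [show ((n + 1 : ℕ) : ℝ) * θ = (n : ℝ) * θ + θ by push_cast; ring]
        exact this
      · have := hdown _ ih.2
        rw [show -(((n + 1 : ℕ) : ℝ) * θ) = -((n : ℝ) * θ) - θ by push_cast; ring]
        exact this
  -- closedness + density of `ℤθ + 2πℤ`
  intro φ t ht
  set T : Set ℝ := {ψ | ∀ x, V t ((((rotZLIE (-ψ)).trans m).trans (rotZLIE ψ)) x) = (((rotZLIE (-ψ)).trans m).trans (rotZLIE ψ)) (V t x)} with hTdef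
  have hTclosed : IsClosed T := by
    have e : T = ⋂ x, {ψ | V t ((((rotZLIE (-ψ)).trans m).trans (rotZLIE ψ)) x) = (((rotZLIE (-ψ)).trans m).trans (rotZLIE ψ)) (V t x)} := by
      ext ψ; simp only [hTdef, mem_setOf_eq, mem_iInter]
    rw [e]
    exact isClosed_iInter fun x =>
      isClosed_eq ((hVc t ht).comp (continuous_rotMirror_angle m x))
        (continuous_rotMirror_angle m (V t x))
  have hsub : (AddSubgroup.closure ({θ, 2 * Real.pi} : Set ℝ) : Set ℝ) ⊆ T := by
    intro ψ hψ
    obtain ⟨j, k, rfl⟩ := AddSubgroup.mem_closure_pair.1 hψ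
    intro x
    rw [zsmul_eq_mul, zsmul_eq_mul, rotMirror_add_int_mul_two_pi, rotMirror_add_int_mul_two_pi]
    obtain ⟨n, hn | hn⟩ := Int.eq_nat_or_neg j
    · rw [hn, Int.cast_natCast]
      exact (hnat n).1 t ht x
    · rw [hn, Int.cast_neg, Int.cast_natCast, neg_mul]
      exact (hnat n).2 t ht x
  have hdense : Dense T := (CorkscrewProfile.Birth.dense_zmultiples_add_of_irrational hθ).mono hsub
  have hTuniv : T = univ := by rw [← hTclosed.closure_eq, hdense.closure_eq]
  intro x
  have hφ : φ ∈ T := by rw [hTuniv]; exact mem_univ _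
  exact hφ x

/-- **T25T / K0g (Oseen gauge): infinite-order twist + ONE non-commuting spatial symmetry ⇒ trivial.**
Type-I ancient mild, `(c, R_θ)`-RDSS on `t < 0` with `θ/2π ∉ ℚ`, and a single linear isometry `m`, not
commuting with the rotations about the axis (reversing: `exists_not_commute_of_reversing`; tilted:
`exists_not_commute_of_tilted`), that is a symmetry of EVERY slice ⇒ `V ≡ 0` on `t < 0`. -/
theorem infiniteTwist_noncommutingIsotropy_trivial {C₀ c θ : ℝ} (hc : 0 < c)
    (hθ : Irrational (θ / (2 * Real.pi))) {m : (EuclideanSpace ℝ (Fin 3)) ≃ₗᵢ[ℝ] (EuclideanSpace ℝ (Fin 3))}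
    (hm : ∃ (φ : ℝ) (y : (EuclideanSpace ℝ (Fin 3))), m (rotZ φ y) ≠ rotZ φ (m y))
    {V : ℝ → (EuclideanSpace ℝ (Fin 3)) → (EuclideanSpace ℝ (Fin 3))} (hV : IsTypeIAncientMild C₀ V) (hdec : HasTypeIDecay C₀ V)
    (hR : ∀ t < 0, ∀ x, c • (rotZLIE θ).symm (V (c ^ 2 * t) (c • rotZLIE θ x)) = V t x)
    (hsym : ∀ t < 0, ∀ x, V t (m x) = m (V t x)) : ∀ t < 0, ∀ x, V t x = 0 := by
  have hVc : ∀ t < 0, Continuous (V t) := fun t ht => slice_continuous hV ht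
  have horbit := conjOrbit_of_infiniteTwist hc hθ m hVc hR hsym
  exact corotatingIsotropy_trivial (α := 1) one_ne_zero hm hV hdec
    fun t ht x => horbit (1 * -Real.log (-t)) t ht x

/-- **K0g at CLASS level** (extends K0d from reversing to every non-commuting `m`, in particular TILTED
ones). Hypothesis list = `RdssProfileTruncation`'s with `R = R_θ`, `θ/2π ∉ ℚ`, plus a.e. `m`-equivariance
of the slices for ONE non-commuting linear isometry `m`: the cell is EMPTY. -/
theorem rdssClass_infiniteTwist_noncommutingIsotropy_empty {θ : ℝ} (hθ : Irrational (θ / (2 * Real.pi)))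
    {m : (EuclideanSpace ℝ (Fin 3)) ≃ₗᵢ[ℝ] (EuclideanSpace ℝ (Fin 3))} (hm : ∃ (φ : ℝ) (y : (EuclideanSpace ℝ (Fin 3))), m (rotZ φ y) ≠ rotZ φ (m y)) (M : ℝ) :
    ¬ ∃ (c : ℝ) (u : ℝ → (EuclideanSpace ℝ (Fin 3)) → (EuclideanSpace ℝ (Fin 3))), 1 < c ∧ IsAncientMildSolution 1 u ∧
      (∀ t < 0, AEStronglyMeasurable (u t) volume) ∧ IsRotatedDSS c (rotZLIE θ) u ∧ HasTypeIDecay M u ∧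
      (∀ t < 0, (fun x => u t (m x)) =ᵐ[volume] fun x => m (u t x)) ∧
      ¬ (∀ t < 0, u t =ᵐ[volume] 0) := by
  rintro ⟨c, u, hc, hmild, hmeas, hR, hdec, hG, hne⟩
  obtain ⟨V, hT, hRV, hVdec, hVu, hV0⟩ := rdssClass_smoothRepresentative_ae hc hmild hmeas hR hdec
  have hVc : ∀ t < 0, Continuous (V t) := fun t ht => slice_continuous hT ht
  have hGV : ∀ t < 0, ∀ x, V t (m x) = m (V t x) := fun t ht =>
    equivariant_of_ae_equivariant m (hVc t ht) (hVu t ht) (hG t ht)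
  have hz := infiniteTwist_noncommutingIsotropy_trivial (lt_trans zero_lt_one hc) hθ hm hT hVdec
    (fun t _ x => hRV t x) hGV
  exact hne fun t ht => by
    filter_upwards [hVu t ht] with x hx
    rw [← hx, hz t ht x]
    rfl

/-- **T25T (Oseen gauge): a TILTED spatio-temporal symmetry at infinite-order twist ⇒ trivial.**
`(c, R_θ)`-RDSS + `(μ, g)`-RDSS on `t < 0` (`g` any linear isometry: a spatio-temporal symmetry),
`θ/2π ∉ ℚ`, and the commutator `g R_θ g⁻¹ R_{−θ}` non-commuting with the rotations about the axis
(the case `g e₃ ≠ ±e₃`) ⇒ `V ≡ 0` on `t < 0`. (For `g` reversing the commutator is `R_{−2θ}` and the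
stronger statement with `θ/π ∉ ℚ` only is the landed `SpatioTemporal.spatioTemporalReversing_trivial`.) -/
theorem spatioTemporal_noncommutingCommutator_trivial {C₀ c μ θ : ℝ} (hc : 0 < c) (hμ : 0 < μ)
    (hθ : Irrational (θ / (2 * Real.pi))) {g : (EuclideanSpace ℝ (Fin 3)) ≃ₗᵢ[ℝ] (EuclideanSpace ℝ (Fin 3))}
    (hm : ∃ (φ : ℝ) (y : (EuclideanSpace ℝ (Fin 3))), g (rotZLIE θ (g.symm ((rotZLIE θ).symm (rotZ φ y)))) ≠
      rotZ φ (g (rotZLIE θ (g.symm ((rotZLIE θ).symm y)))))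
    {V : ℝ → (EuclideanSpace ℝ (Fin 3)) → (EuclideanSpace ℝ (Fin 3))} (hV : IsTypeIAncientMild C₀ V) (hdec : HasTypeIDecay C₀ V)
    (hR : ∀ t < 0, ∀ x, c • (rotZLIE θ).symm (V (c ^ 2 * t) (c • rotZLIE θ x)) = V t x)
    (hG : ∀ t < 0, ∀ x, μ • g.symm (V (μ ^ 2 * t) (μ • g x)) = V t x) :
    ∀ t < 0, ∀ x, V t x = 0 := by
  -- the commutator as a linear isometry
  set m : (EuclideanSpace ℝ (Fin 3)) ≃ₗᵢ[ℝ] (EuclideanSpace ℝ (Fin 3)) := (((rotZLIE θ).symm.trans g.symm).trans (rotZLIE θ)).trans g with hmdef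
  have hm_apply : ∀ x, m x = g (rotZLIE θ (g.symm ((rotZLIE θ).symm x))) := fun x => rfl
  have hsym : ∀ t < 0, ∀ x, V t (m x) = m (V t x) := by
    intro t ht x
    rw [hm_apply, hm_apply]
    exact SpatioTemporal.slices_equivariant_commutator hc hμ hR hG t ht x
  have hm' : ∃ (φ : ℝ) (y : (EuclideanSpace ℝ (Fin 3))), m (rotZ φ y) ≠ rotZ φ (m y) := by
    obtain ⟨φ, y, hne⟩ := hm
    exact ⟨φ, y, by rwa [hm_apply, hm_apply]⟩
  exact infiniteTwist_noncommutingIsotropy_trivial hc hθ hm' hV hdec hR hsym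

/-- **T25T at CLASS level.** Hypothesis list = `RdssProfileTruncation`'s with `R = R_θ`, `θ/2π ∉ ℚ`, plus
ONE spatio-temporal symmetry `IsRotatedDSS μ g u` (`μ > 0`) whose commutator with the twist does not
commute with the rotations about the axis: the cell is EMPTY. -/
theorem rdssClass_spatioTemporal_noncommutingCommutator_empty {θ : ℝ}
    (hθ : Irrational (θ / (2 * Real.pi))) {g : (EuclideanSpace ℝ (Fin 3)) ≃ₗᵢ[ℝ] (EuclideanSpace ℝ (Fin 3))}
    (hm : ∃ (φ : ℝ) (y : (EuclideanSpace ℝ (Fin 3))), g (rotZLIE θ (g.symm ((rotZLIE θ).symm (rotZ φ y)))) ≠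
      rotZ φ (g (rotZLIE θ (g.symm ((rotZLIE θ).symm y))))) (M : ℝ) :
    ¬ ∃ (c μ : ℝ) (u : ℝ → (EuclideanSpace ℝ (Fin 3)) → (EuclideanSpace ℝ (Fin 3))), 1 < c ∧ 0 < μ ∧ IsAncientMildSolution 1 u ∧
      (∀ t < 0, AEStronglyMeasurable (u t) volume) ∧ IsRotatedDSS c (rotZLIE θ) u ∧ HasTypeIDecay M u ∧
      IsRotatedDSS μ g u ∧ ¬ (∀ t < 0, u t =ᵐ[volume] 0) := by
  rintro ⟨c, μ, u, hc, hμ, hmild, hmeas, hR, hdec, hG, hne⟩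
  obtain ⟨V, hT, hRV, hVdec, hVu, hV0⟩ := rdssClass_smoothRepresentative_ae hc hmild hmeas hR hdec
  have hVc : ∀ t < 0, Continuous (V t) := fun t ht => slice_continuous hT ht
  have hGV : IsRotatedDSS μ g V := isRotatedDSS_of_ae_slice_eq hμ hG hVc hVu hV0
  have hz := spatioTemporal_noncommutingCommutator_trivial (lt_trans zero_lt_one hc) hμ hθ hm hT hVdec
    (fun t _ x => hRV t x) (fun t _ x => hGV t x)
  exact hne fun t ht => by
    filter_upwards [hVu t ht] with x hx
    rw [← hx, hz t ht x]
    rfl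

end Summit.NavierStokesRegularity.NavierStokesRegularity.Theorems.TiltedIsotropy

end
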